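import Mathlib
import HarnessLib
import Summits.NavierStokesRegularity.NavierStokesRegularity.Theorems.PoloidalWindowDoorPoloidalWindowRigiditySparseEnergyRound
import Summits.NavierStokesRegularity.NavierStokesRegularity.Theorems.PoloidalWindowDoorPoloidalWindowRigiditySparseEnergyEnvFlux
import Summits.NavierStokesRegularity.NavierStokesRegularity.Theorems.PoloidalWindowDoorPoloidalWindowRigiditySparseEnergyEnvelope

/-!
# Route `PoloidalWindowDoor`, crux `PoloidalWindowRigidity` (stmt-19708), line `sparse_energy` (cstrat g11) —
# stub S1 `stub_scaledEnergy`, near-apex bootstrap: THE ENVELOPE ROUND — from the induction hypothesis `E ≤ Φ_γ` and a pressure split to the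
# next envelope, for one exponent `γ`

Seat ns-poloidal-K2-p2 g9 (successor of the interim LEAD-of-record on 19708; file `--supports`).  Composition of `…SparseEnergyRound.energy_round`
(the round with the flux majorant as hypothesis), `…SparseEnergyEnvFlux.abs_flux_le_envelope` (flux under envelope values) and
`…SparseEnergyEnvelope` (`envelope_smul_radius`, `hasSum_envelope_dyadic`).  The PRESSURE SPLIT is a hypothesis in the consumer form agreed with
ns-es-p1 (`Literature/…/RieszPressureModConst`, in typing): for every slice `t` of the window and every ball, `q(t) = c + p₁ + p₂` on `B̄(a,2R)`,
`√(∫_{B̄(a,2R)} p₁²) ≤ κ₁ (C/√(−t)) √E(a,8R,t)` and `osc_{B̄(a,2R)} p₂ ≤ κ₂ R Σ_k (2^kR)⁻⁴ E(a,2^{k+1}R,t)`, `E(a,ρ,t) = ∫ cutoff ρ (a−·)|v(t)|²`.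

* `envelope_round` — class profile, window pressure with that split, induction hypothesis IH(γ,K) on the near regime (`−t ≤ ρ² ⇒ E(a,ρ,t) ≤ Kρ(ρ²/(−t))^γ`),
  `0 ≤ γ < 3/2`, `γ ∉ {1, ½, ⅔}`: for every `a`, `R > 0`, `t₀ ∈ (−R², 0)`,
  `E(a,R,t₀) + 2∫_{−R²}^{t₀}∫|Dv|²_F cutoff R (a−·) ≤ (A+B)R + Σ_b c_b ((R²)^{1−b} − (−t₀)^{1−b})/(1−b)`, `b ∈ {γ, γ+½, 3γ/2}`, with the EXPLICIT
  `c_γ = K l₂C_Δ R^{2γ−1}`, `c_{γ+½} = K(l₂C_∇ + 2C_∇κ₁√(l₈l₂))C R^{2γ}`, `c_{3γ/2} = 2C_∇κ₂c_f√(8V₁l₂)K√K R^{3γ−1}`, `l₂ = 2^{1+2γ}`, `l₈ = 8^{1+2γ}`,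
  `c_f = 2^{1+2γ}/(1 − 2^{2γ−3})`.
The three bootstrap rounds (γ = 17/16 → 5/8 → 1/8 → 0 after weakening, `…Envelope.envelope_weaken`) and the assembly with `…FarField.scaledEnergy_far` are
left to the next file (K2-p2 g10).

WHAT THIS IS NOT: not a claim about Navier–Stokes, not S1 — one round of its near-apex half, conditional on the pressure split (bears_on LADDER-NS N0 via
crux 19708, line sparse_energy, stub S1). [folklore]
-/

noncomputable section

-- the summit and its single sub-problem share the name (CONVENTIONS §1), as in every Theorems file
set_option linter.dupNamespace false

namespace Summit.NavierStokesRegularity.NavierStokesRegularity.Theorems.PoloidalWindowDoorPoloidalWindowRigiditySparseEnergyEnvRound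

open MeasureTheory Set Function Filter Topology Metric intervalIntegral
open scoped RealInnerProductSpace InnerProductSpace Laplacian ENNReal
open Literature.Analysis Literature.Analysis.FluidPDE
open Summit.NavierStokesRegularity.NavierStokesRegularity.Theorems.PoloidalWindowDoorPoloidalWindowRigiditySparseEnergyRound
open Summit.NavierStokesRegularity.NavierStokesRegularity.Theorems.PoloidalWindowDoorPoloidalWindowRigiditySparseEnergyEnvFlux
open Summit.NavierStokesRegularity.NavierStokesRegularity.Theorems.PoloidalWindowDoorPoloidalWindowRigiditySparseEnergyEnvelope

variable {C : ℝ} {v : ℝ → EuclideanSpace ℝ (Fin 3) → EuclideanSpace ℝ (Fin 3)}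

/-- **THE ENVELOPE ROUND** (see the module docstring). [folklore] -/
theorem envelope_round (hrate : HasTypeITimeDecay C v)
    (hcont : ContinuousOn (uncurry v) (Iio (0 : ℝ) ×ˢ univ))
    (hmild : ∀ s t : ℝ, s < t → t < 0 → ∀ x,
      v t x = UnboundedOperators.heatExtension (v s) (t - s) x - oseenDuhamel 1 s v v t x)
    (hdiv : ∀ t < 0, VectorCalculus.IsDivFree (v t)) {Cl Cg : ℝ}
    (hCl : ∀ R : ℝ, 0 < R → ∀ x : EuclideanSpace ℝ (Fin 3), |(Δ (cutoff R : EuclideanSpace ℝ (Fin 3) → ℝ)) x| ≤ Cl / R ^ 2)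
    (hCg : ∀ R : ℝ, 0 < R → ∀ x : EuclideanSpace ℝ (Fin 3), ‖fderiv ℝ (cutoff R : EuclideanSpace ℝ (Fin 3) → ℝ) x‖ ≤ Cg / R) :
    ∃ A B : ℝ, 0 ≤ A ∧ 0 ≤ B ∧ ∀ (T : ℝ) (q : ℝ → EuclideanSpace ℝ (Fin 3) → ℝ), IsClassicalNSSolutionOn (Ioo T 0) 1 0 v q →
      ∀ (κ₁ κ₂ : ℝ), 0 ≤ κ₁ → 0 ≤ κ₂ →
      (∀ t ∈ Ioo T 0, ∀ (a : EuclideanSpace ℝ (Fin 3)) (R : ℝ), 0 < R →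
        ∃ (c : ℝ) (p₁ p₂ : EuclideanSpace ℝ (Fin 3) → ℝ), Continuous p₁ ∧ (∀ x ∈ closedBall a (2 * R), q t x = c + p₁ x + p₂ x) ∧
          Real.sqrt (∫ x in closedBall a (2 * R), p₁ x ^ 2) ≤
            κ₁ * (C / Real.sqrt (-t)) * Real.sqrt (∫ x, cutoff (8 * R) (a - x) * ‖v t x‖ ^ 2) ∧
          ∃ O : ℝ, 0 ≤ O ∧ (∀ x ∈ closedBall a (2 * R), ∀ y ∈ closedBall a (2 * R), |p₂ x - p₂ y| ≤ O) ∧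
            O ≤ κ₂ * R * ∑' k : ℕ, ((2 : ℝ) ^ k * R)⁻¹ ^ 4 * ∫ x, cutoff ((2 : ℝ) ^ (k + 1) * R) (a - x) * ‖v t x‖ ^ 2) →
      ∀ (K γ : ℝ), 0 ≤ K → 0 ≤ γ → γ < 3 / 2 → γ ≠ 1 → γ ≠ 1 / 2 → γ ≠ 2 / 3 →
      (∀ (a : EuclideanSpace ℝ (Fin 3)) (ρ t : ℝ), 0 < ρ → t < 0 → -t ≤ ρ ^ 2 →
        ∫ x, cutoff ρ (a - x) * ‖v t x‖ ^ 2 ≤ K * ρ * (ρ ^ 2 / (-t)) ^ γ) →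
      ∀ (a : EuclideanSpace ℝ (Fin 3)) (R : ℝ), 0 < R → T < -R ^ 2 → ∀ t₀ : ℝ, -R ^ 2 < t₀ → t₀ < 0 →
        (∫ x, cutoff R (a - x) * ‖v t₀ x‖ ^ 2) + 2 * ∫ t in (-R ^ 2)..t₀, ∫ x, frobeniusNormSq (fderiv ℝ (v t) x) * cutoff R (a - x) ≤
          A * R ^ 2 / Real.sqrt (R ^ 2) + B * R ^ 3 / R ^ 2 +
            (K * ((2 : ℝ) ^ (1 + 2 * γ) * Cl) * R ^ (2 * γ - 1) * (((R ^ 2) ^ (1 - γ) - (-t₀) ^ (1 - γ)) / (1 - γ)) +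
              K * ((2 : ℝ) ^ (1 + 2 * γ) * Cg + 2 * Cg * κ₁ * Real.sqrt ((8 : ℝ) ^ (1 + 2 * γ) * (2 : ℝ) ^ (1 + 2 * γ))) * C * R ^ (2 * γ) *
                (((R ^ 2) ^ (1 - (γ + 1 / 2)) - (-t₀) ^ (1 - (γ + 1 / 2))) / (1 - (γ + 1 / 2))) +
              (2 * Cg * κ₂ * ((2 : ℝ) ^ (1 + 2 * γ) / (1 - (2 : ℝ) ^ ((1 + 2 * γ) - 4))) *
                  Real.sqrt (8 * (volume (ball (0 : EuclideanSpace ℝ (Fin 3)) 1)).toReal * (2 : ℝ) ^ (1 + 2 * γ))) * K * Real.sqrt K *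
                R ^ (3 * γ - 1) * (((R ^ 2) ^ (1 - 3 * γ / 2) - (-t₀) ^ (1 - 3 * γ / 2)) / (1 - 3 * γ / 2))) := by
  obtain ⟨A, B, hA, hB, hround⟩ := energy_round hrate hcont hmild hdiv
  refine ⟨A, B, hA, hB, fun T q hcl κ₁ κ₂ hκ₁ hκ₂ hsplit K γ hK hγ0 hγ32 hγ1 hγ2 hγ3 IH a R hR hT t₀ ht₀l ht₀ => ?_⟩
  have hC0 : 0 ≤ C := by
    have h := hrate (-1) (by norm_num) 0
    rw [neg_neg, Real.sqrt_one, div_one] at h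
    exact (norm_nonneg _).trans h
  set l₂ : ℝ := (2 : ℝ) ^ (1 + 2 * γ) with hl₂
  set l₈ : ℝ := (8 : ℝ) ^ (1 + 2 * γ) with hl₈
  set cf : ℝ := (2 : ℝ) ^ (1 + 2 * γ) / (1 - (2 : ℝ) ^ ((1 + 2 * γ) - 4)) with hcf
  have hl₂0 : 0 ≤ l₂ := Real.rpow_nonneg zero_le_two _
  have hl₈0 : 0 ≤ l₈ := Real.rpow_nonneg (by norm_num) _
  have hcf0 : 0 ≤ cf := by
    have h1 : (2 : ℝ) ^ ((1 + 2 * γ) - 4) < 1 := Real.rpow_lt_one_of_one_lt_of_neg one_lt_two (by linarith)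
    exact div_nonneg hl₂0 (by linarith)
  refine hround T q hcl a R hR hT t₀ ht₀l ht₀ K (l₂ * Cl) (l₂ * Cg + 2 * Cg * κ₁ * Real.sqrt (l₈ * l₂))
    (2 * Cg * κ₂ * cf * Real.sqrt (8 * (volume (ball (0 : EuclideanSpace ℝ (Fin 3)) 1)).toReal * l₂)) C γ hK hγ1 hγ2 hγ3
    fun t ht => ?_
  -- the flux majorant at the slice `t ∈ (−R², t₀]`
  have ht0 : t < 0 := lt_of_le_of_lt ht.2 ht₀
  have hτ : 0 < -t := neg_pos.2 ht0
  have htT : t ∈ Ioo T 0 := ⟨hT.trans ht.1, ht0⟩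
  have htR : -t ≤ R ^ 2 := by linarith [ht.1]
  obtain ⟨c, p₁, p₂, hp₁, hdec, hN, O, hO0, hosc, hOle⟩ := hsplit t htT a R hR
  have hu : ContDiff ℝ 1 (v t) := (hcl.smooth_velocity.contDiff_slice htT).of_le (by exact_mod_cast le_top)
  have hp : ContDiff ℝ 1 (q t) := (hcl.smooth_pressure.contDiff_slice htT).of_le (by exact_mod_cast le_top)
  have hdivt : ∀ x, VectorCalculus.divergence (v t) x = 0 := hcl.divFree t htT
  set P : ℝ := (R ^ 2 / (-t)) ^ γ with hP
  have hP0 : 0 ≤ P := Real.rpow_nonneg (by positivity) _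
  -- envelope at `2R`, `8R`
  have hIH2 : ∫ x, cutoff (2 * R) (a - x) * ‖v t x‖ ^ 2 ≤ l₂ * K * R * P := by
    have h := IH a (2 * R) t (by positivity) ht0 (by nlinarith)
    rw [envelope_smul_radius K γ two_pos hR hτ] at h
    simpa [hl₂, hP, mul_assoc, mul_comm, mul_left_comm] using h
  have hIH8 : ∫ x, cutoff (8 * R) (a - x) * ‖v t x‖ ^ 2 ≤ l₈ * K * R * P := by
    have h := IH a (8 * R) t (by positivity) ht0 (by nlinarith)
    rw [envelope_smul_radius K γ (by norm_num : (0 : ℝ) < 8) hR hτ] at h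
    simpa [hl₈, hP, mul_assoc, mul_comm, mul_left_comm] using h
  -- the far sum under the envelope
  have hfar : HasSum (fun k : ℕ => ((2 : ℝ) ^ k * R)⁻¹ ^ 4 * (K * ((2 : ℝ) ^ (k + 1) * R) * ((((2 : ℝ) ^ (k + 1) * R) ^ 2 / (-t)) ^ γ)))
      (cf * ((R⁻¹) ^ 4 * (K * R * P))) := by
    rw [hcf, hP]; exact hasSum_envelope_dyadic K hγ32 hR hτ
  have hle : ∀ k : ℕ, ((2 : ℝ) ^ k * R)⁻¹ ^ 4 * ∫ x, cutoff ((2 : ℝ) ^ (k + 1) * R) (a - x) * ‖v t x‖ ^ 2 ≤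
      ((2 : ℝ) ^ k * R)⁻¹ ^ 4 * (K * ((2 : ℝ) ^ (k + 1) * R) * ((((2 : ℝ) ^ (k + 1) * R) ^ 2 / (-t)) ^ γ)) := by
    intro k
    have h2k : (0 : ℝ) < (2 : ℝ) ^ (k + 1) * R := by positivity
    refine mul_le_mul_of_nonneg_left (IH a _ t h2k ht0 ?_) (by positivity)
    have h1 : (1 : ℝ) ≤ (2 : ℝ) ^ (k + 1) := one_le_pow₀ (by norm_num)
    nlinarith [mul_le_mul_of_nonneg_right h1 hR.le, sq_nonneg R]
  have hnn : ∀ k : ℕ, 0 ≤ ((2 : ℝ) ^ k * R)⁻¹ ^ 4 * ∫ x, cutoff ((2 : ℝ) ^ (k + 1) * R) (a - x) * ‖v t x‖ ^ 2 :=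
    fun k => mul_nonneg (by positivity) (integral_nonneg fun x => mul_nonneg (cutoff_nonneg _ _) (sq_nonneg _))
  have hsum : Summable fun k : ℕ => ((2 : ℝ) ^ k * R)⁻¹ ^ 4 * ∫ x, cutoff ((2 : ℝ) ^ (k + 1) * R) (a - x) * ‖v t x‖ ^ 2 :=
    Summable.of_nonneg_of_le hnn hle hfar.summable
  have htsum : ∑' k : ℕ, ((2 : ℝ) ^ k * R)⁻¹ ^ 4 * ∫ x, cutoff ((2 : ℝ) ^ (k + 1) * R) (a - x) * ‖v t x‖ ^ 2 ≤
      cf * ((R⁻¹) ^ 4 * (K * R * P)) := by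
    rw [← hfar.tsum_eq]; exact hsum.tsum_le_tsum hle hfar.summable
  have hOle' : O ≤ κ₂ * cf * K * P / R ^ 2 := by
    refine hOle.trans ?_
    have h := mul_le_mul_of_nonneg_left htsum (mul_nonneg hκ₂ hR.le)
    refine h.trans (le_of_eq ?_)
    field_simp
  -- the envelope flux bound at the slice
  have hflux := abs_flux_le_envelope hR hCl hCg hu hdivt hp hp₁ hdec (M := C / Real.sqrt (-t)) (by positivity) hO0 hK hP0 hl₂0 hl₈0 hκ₁ hκ₂
    hcf0 (fun x => hrate t ht0 x) hosc hIH2 hIH8 hN hOle'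
  rw [hP] at hflux
  refine hflux.trans (le_of_eq ?_)
  ring

end Summit.NavierStokesRegularity.NavierStokesRegularity.Theorems.PoloidalWindowDoorPoloidalWindowRigiditySparseEnergyEnvRound

end
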